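import Mathlib
import Summits.ValiantsHypothesis.ValiantsHypothesis.Theorems.BarrierLeverPartitionMinorsHitByVPHiddenStatesTwoLayerWitness

/-!
# Route BarrierLever — item `PartitionMinorsHitByVP` (stmt-ValiantsHypothesis-19717), line `hidden-states`,
# stub `stub_qjoinSharp` (Q_join(h²)): THE FREE-POINT ENGINE FOR JOINS — zeta cores + curve filling

Helper file (`--supports stmt-ValiantsHypothesis-19717`; cell valiant-natproofs, rung V4, 𝒟-side door (c); prover seat
val-np-p8 gen 3, lane `stub_qjoinSharp` of the registered line `Cruxes/PartitionMinorsHitByVP/Lines/hidden_states.lean`).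
Definition-light (bookkeeping `jpt`, `jcol`, the predicate `IndepOn`, `fillTab`); closes NO item.

SETTING. A JOIN hidden family is `e : n → Fin m × Finset (Fin K)` (piece, set of states) with a JOIN TABLE
`tx : Fin m → Option (Fin K) → Fin h → ℂ`; column `k` is the point `jpt tx (e k) = tx p none + Σ_{q ∈ J} tx p (some q)`
(`(p, J) = e k`) and the block-additive matrix of the stubs `stub_universalJoinWide` / `stub_qjoinSharp` is
`[∏_{a ∈ u i} jpt tx (e k) a]_{i,k}`.

THE ENGINE (`exists_table_of_core`). Split the columns into a CORE `A` and FREE columns: a free column `k ∉ A` is a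
PRIVATE SINGLETON — `(e k).2 = {q}` with the state `q` occurring in no other column of the same piece. If some table `tx₀`
makes the core columns `(∏_{a∈u i} jpt tx₀ (e k) a)_i`, `k ∈ A`, linearly independent, then SOME join table makes the whole
matrix nonsingular: keep `tx₀` on the core and send each free column to a point of the moment curve `(s^{2^a})_a`, which
leaves every proper subspace (`TwoLayer.exists_curveVec_not_mem`, val-np-p3 g9), one column at a time. So goodness of a
join for a row family `u` is EXACTLY independence of its structured columns on `u`; free satellites never obstruct.

ZETA CORES (`indepOn_of_labels`). If the core points can be made 0/1 INDICATOR vectors of distinct members `u (φ k)` of the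
row family, the core columns are the zeta vectors `[u i ⊆ u (φ k)]_i` and are independent (`TwoLayer.eq_zero_of_zeta`).

USE (this seat's next file): HUB JOINS — pieces `{∅, {0}} ∪ singletons ∪ {{0,i} : i ≤ l}` (a hub married to `l` leaves;
a legal threshold family) are good for every row family containing a large enough PARALLEL CLASS (pairs `S ↦ (S∖X)∪Y`);
in particular all few-vertex uniform / skeleton / ball / cube families — the killers of every single-cube door — are
harmless for hub joins up to `r = 4h³`. WHAT THIS IS NOT: no claim on `stub_qjoinSharp` for ALL `u` beyond the star range
`2h(h²+1)` (p578997); nothing on crux 14610 or VP ≠ VNP.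
-/

set_option linter.dupNamespace false

namespace Summit.ValiantsHypothesis.ValiantsHypothesis.Theorems.BarrierLever.HiddenStates

open Finset Matrix

noncomputable section

namespace JoinFilling

open TwoLayer (curveVec exists_curveVec_not_mem)

variable {h m K : ℕ} {n : Type*}

/-! ## 1. Join points and join columns -/

/-- The point of the join column `(p, J)` under the join table `tx`: `tx p none + Σ_{q∈J} tx p (some q)`. -/
def jpt (tx : Fin m → Option (Fin K) → Fin h → ℂ) (x : Fin m × Finset (Fin K)) (a : Fin h) : ℂ :=
  tx x.1 none a + ∑ q ∈ x.2, tx x.1 (some q) a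

/-- The column vector of column `k`: `i ↦ ∏_{a ∈ u i} jpt tx (e k) a`. -/
def jcol (u : n → Finset (Fin h)) (e : n → Fin m × Finset (Fin K)) (tx : Fin m → Option (Fin K) → Fin h → ℂ)
    (k : n) : n → ℂ :=
  fun i => ∏ a ∈ u i, jpt tx (e k) a

/-- Linear independence of the vectors `col k`, `k ∈ A`. -/
def IndepOn (col : n → (n → ℂ)) (A : Finset n) : Prop :=
  ∀ α : n → ℂ, (∀ k, k ∉ A → α k = 0) → ∑ k ∈ A, α k • col k = 0 → ∀ k, α k = 0

variable [Fintype n] [DecidableEq n]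

/-- Independence of ALL columns gives a nonsingular block-additive matrix. -/
theorem det_ne_zero_of_indepOn (u : n → Finset (Fin h)) (e : n → Fin m × Finset (Fin K))
    (tx : Fin m → Option (Fin K) → Fin h → ℂ) (hind : IndepOn (jcol u e tx) Finset.univ) :
    (Matrix.of fun i k : n =>
      ∏ a ∈ u i, (tx (e k).1 none a + ∑ q ∈ (e k).2, tx (e k).1 (some q) a)).det ≠ 0 := by
  classical
  intro hdet
  obtain ⟨α, hαne, hαmul⟩ := Matrix.exists_mulVec_eq_zero_iff.mpr hdet
  apply hαne
  funext k
  refine hind α (fun k hk => absurd (Finset.mem_univ k) hk) ?_ k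
  funext i
  have := congrFun hαmul i
  rw [Matrix.mulVec, dotProduct] at this
  simp only [Matrix.of_apply, Pi.zero_apply] at this
  rw [Finset.sum_apply, Pi.zero_apply]
  simpa [Pi.smul_apply, smul_eq_mul, mul_comm, jcol, jpt] using this

/-! ## 2. Curve filling: free columns complete any independent core -/

/-- **One filling step.** If the columns on `A` are independent and `k₁ ∉ A`, then replacing column `k₁` by a suitable
curve vector keeps the enlarged family independent. -/
theorem fill_step (u : n → Finset (Fin h)) (hu : Function.Injective u) (col : n → (n → ℂ)) (A : Finset n)
    (hA : IndepOn col A) (k₁ : n) (hk₁ : k₁ ∉ A) :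
    ∃ s : ℂ, IndepOn (Function.update col k₁ (curveVec u s)) (insert k₁ A) := by
  classical
  -- the span of the columns on A is a proper subspace
  set W : Submodule ℂ (n → ℂ) := Submodule.span ℂ (Set.range fun k : A => col k) with hW
  have hWlt : W < ⊤ := by
    have h1 : Module.finrank ℂ W ≤ Fintype.card A := finrank_range_le_card _
    have h2 : Fintype.card A < Fintype.card n := by
      rw [Fintype.card_coe]
      exact Finset.card_lt_card (Finset.ssubset_iff_subset_ne.mpr ⟨Finset.subset_univ A,
        fun h' => hk₁ (h' ▸ Finset.mem_univ k₁)⟩)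
    have h3 : Module.finrank ℂ (n → ℂ) = Fintype.card n := Module.finrank_fintype_fun_eq_card ℂ
    exact Submodule.lt_top_of_finrank_lt_finrank (by omega)
  obtain ⟨s, hs⟩ := exists_curveVec_not_mem u hu W hWlt
  refine ⟨s, fun α hαA hsum => ?_⟩
  set col' := Function.update col k₁ (curveVec u s) with hcol'
  have hsame : ∀ k ∈ A, col' k = col k := fun k hk => by
    have hne : k ≠ k₁ := by rintro rfl; exact hk₁ hk
    rw [hcol', Function.update_of_ne hne]
  have hnew : col' k₁ = curveVec u s := by rw [hcol', Function.update_self]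
  -- if α k₁ ≠ 0 the curve vector would lie in W
  have hαk₁ : α k₁ = 0 := by
    by_contra hne
    apply hs
    rw [Finset.sum_insert hk₁, hnew] at hsum
    have hT : ∑ k ∈ A, α k • col' k = ∑ k ∈ A, α k • col k :=
      Finset.sum_congr rfl fun k hk => by rw [hsame k hk]
    rw [hT] at hsum
    have h1 : α k₁ • curveVec u s = -∑ k ∈ A, α k • col k := eq_neg_of_add_eq_zero_left hsum
    have hexpr : curveVec u s = -(α k₁)⁻¹ • ∑ k ∈ A, α k • col k := by
      calc curveVec u s = (α k₁)⁻¹ • (α k₁ • curveVec u s) := by rw [smul_smul, inv_mul_cancel₀ hne, one_smul]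
        _ = -(α k₁)⁻¹ • ∑ k ∈ A, α k • col k := by rw [h1, smul_neg, neg_smul]
    rw [hexpr]
    refine Submodule.smul_mem _ _ (Submodule.sum_mem _ fun k hk => Submodule.smul_mem _ _ ?_)
    exact Submodule.subset_span ⟨⟨k, hk⟩, rfl⟩
  -- then α is supported on A
  have hαA' : ∀ k, k ∉ A → α k = 0 := by
    intro k hk
    by_cases hkk : k = k₁
    · rw [hkk]; exact hαk₁
    · exact hαA k (fun h' => by rcases Finset.mem_insert.mp h' with h'' | h''; exact hkk h''; exact hk h'')
  have hsum' : ∑ k ∈ A, α k • col k = 0 := by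
    rw [Finset.sum_insert hk₁, hαk₁, zero_smul, zero_add] at hsum
    rw [← hsum]
    exact Finset.sum_congr rfl fun k hk => by rw [hsame k hk]
  exact hA α hαA' hsum'

/-- **Filling.** If the columns `col k`, `k ∈ A`, are independent, then after replacing every column outside `A` by a
suitable curve vector ALL columns are independent. -/
theorem fill_all (u : n → Finset (Fin h)) (hu : Function.Injective u) (col : n → (n → ℂ)) (A : Finset n)
    (hA : IndepOn col A) :
    ∃ z : n → ℂ, IndepOn (fun k => if k ∈ A then col k else curveVec u (z k)) Finset.univ := by
  classical
  -- induction over a finset D of added columns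
  have H : ∀ D : Finset n, ∃ z : n → ℂ, IndepOn (fun k => if k ∈ A then col k else curveVec u (z k)) (A ∪ D) := by
    intro D
    induction D using Finset.induction_on with
    | empty =>
      refine ⟨fun _ => 0, ?_⟩
      rw [Finset.union_empty]
      intro α hαA hsum
      refine hA α hαA ?_
      rw [← hsum]
      exact Finset.sum_congr rfl fun k hk => by simp only [if_pos hk]
    | @insert k₁ D hk₁D ih =>
      obtain ⟨z, hz⟩ := ih
      by_cases hk₁ : k₁ ∈ A ∪ D
      · refine ⟨z, ?_⟩
        rwa [Finset.union_insert, Finset.insert_eq_of_mem hk₁]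
      · obtain ⟨s, hs⟩ := fill_step u hu _ (A ∪ D) hz k₁ hk₁
        refine ⟨Function.update z k₁ s, ?_⟩
        rw [Finset.union_insert]
        have hk₁A : k₁ ∉ A := fun h' => hk₁ (Finset.mem_union_left D h')
        convert hs using 2 with k
        by_cases hkk : k = k₁
        · subst hkk
          rw [if_neg hk₁A, Function.update_self, Function.update_self]
        · rw [Function.update_of_ne hkk, Function.update_of_ne hkk]
  obtain ⟨z, hz⟩ := H Finset.univ
  have hAu : A ∪ Finset.univ = Finset.univ := Finset.union_eq_right.mpr (Finset.subset_univ A)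
  exact ⟨z, by rwa [hAu] at hz⟩

/-! ## 3. Realising the filling by a join table: private free states -/

section realise

variable (u : n → Finset (Fin h)) (e : n → Fin m × Finset (Fin K)) (A : Finset n) (priv : n → Fin K)
  (tx₀ : Fin m → Option (Fin K) → Fin h → ℂ)

/-- The filled table: core states keep `tx₀`; the private state of a free column `k` is moved so that the column's point
becomes the curve point `(z k ^ 2^a)_a`. -/
def fillTab (z : n → ℂ) : Fin m → Option (Fin K) → Fin h → ℂ
  | p, none => tx₀ p none
  | p, some q => fun a => tx₀ p (some q) a +
      ∑ k ∈ Finset.univ.filter (fun k => k ∉ A ∧ (e k).1 = p ∧ priv k = q), (z k ^ (2 ^ (a : ℕ)) - tx₀ p none a - tx₀ p (some q) a)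

variable {u e A priv tx₀}

/-- On a core column the filled table gives the core point. -/
theorem jpt_fillTab_core
    (hpriv : ∀ k, k ∉ A → ∀ k', (e k').1 = (e k).1 → priv k ∈ (e k').2 → k' = k)
    (z : n → ℂ) (k : n) (hk : k ∈ A) (a : Fin h) :
    jpt (fillTab e A priv tx₀ z) (e k) a = jpt tx₀ (e k) a := by
  classical
  unfold jpt
  simp only [fillTab]
  congr 1
  refine Finset.sum_congr rfl fun q hq => ?_
  rw [add_eq_left]
  refine Finset.sum_eq_zero fun k' hk' => ?_
  exfalso
  simp only [Finset.mem_filter, Finset.mem_univ, true_and] at hk'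
  obtain ⟨hk'A, hp, hpq⟩ := hk'
  have := hpriv k' hk'A k hp.symm (hpq ▸ hq)
  exact hk'A (this ▸ hk)

/-- On a free column the filled table gives the curve point. -/
theorem jpt_fillTab_free (hsingle : ∀ k, k ∉ A → (e k).2 = {priv k})
    (hpriv : ∀ k, k ∉ A → ∀ k', (e k').1 = (e k).1 → priv k ∈ (e k').2 → k' = k)
    (z : n → ℂ) (k : n) (hk : k ∉ A) (a : Fin h) :
    jpt (fillTab e A priv tx₀ z) (e k) a = z k ^ (2 ^ (a : ℕ)) := by
  classical
  unfold jpt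
  rw [hsingle k hk, Finset.sum_singleton]
  simp only [fillTab]
  have hfilter : Finset.univ.filter (fun k' => k' ∉ A ∧ (e k').1 = (e k).1 ∧ priv k' = priv k) = {k} := by
    ext k'
    simp only [Finset.mem_filter, Finset.mem_univ, true_and, Finset.mem_singleton]
    constructor
    · rintro ⟨hk'A, hp, hpq⟩
      have hmem : priv k' ∈ (e k).2 := by rw [hsingle k hk, ← hpq]; exact Finset.mem_singleton_self _
      exact (hpriv k' hk'A k hp.symm hmem).symm
    · rintro rfl; exact ⟨hk, rfl, rfl⟩
  rw [hfilter, Finset.sum_singleton]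
  ring

/-- The filled columns: core columns unchanged, free columns = curve vectors. -/
theorem jcol_fillTab (hsingle : ∀ k, k ∉ A → (e k).2 = {priv k})
    (hpriv : ∀ k, k ∉ A → ∀ k', (e k').1 = (e k).1 → priv k ∈ (e k').2 → k' = k) (z : n → ℂ) (k : n) :
    jcol u e (fillTab e A priv tx₀ z) k = if k ∈ A then jcol u e tx₀ k else curveVec u (z k) := by
  classical
  funext i
  by_cases hk : k ∈ A
  · rw [if_pos hk]
    simp only [jcol]
    exact Finset.prod_congr rfl fun a _ => jpt_fillTab_core hpriv z k hk a
  · rw [if_neg hk]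
    simp only [jcol, curveVec]
    rw [Finset.prod_congr rfl fun a _ => jpt_fillTab_free (tx₀ := tx₀) hsingle hpriv z k hk a, Finset.prod_pow_eq_pow_sum]

/-- **THE FREE-POINT ENGINE.** If the free columns are private singletons and some table makes the CORE columns independent on
the (injective) row family, then some join table makes the whole block-additive matrix nonsingular. Privacy: a free
column `k ∉ A` is the singleton `{priv k}` and `priv k` occurs in no other column of the same piece. -/
theorem exists_table_of_core (hu : Function.Injective u) (hsingle : ∀ k, k ∉ A → (e k).2 = {priv k})
    (hpriv : ∀ k, k ∉ A → ∀ k', (e k').1 = (e k).1 → priv k ∈ (e k').2 → k' = k)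
    (hcore : IndepOn (jcol u e tx₀) A) :
    ∃ tx : Fin m → Option (Fin K) → Fin h → ℂ,
      (Matrix.of fun i k : n =>
        ∏ a ∈ u i, (tx (e k).1 none a + ∑ q ∈ (e k).2, tx (e k).1 (some q) a)).det ≠ 0 := by
  classical
  obtain ⟨z, hz⟩ := fill_all u hu (jcol u e tx₀) A hcore
  refine ⟨fillTab e A priv tx₀ z, det_ne_zero_of_indepOn u e _ ?_⟩
  have hcols : jcol u e (fillTab e A priv tx₀ z) = fun k => if k ∈ A then jcol u e tx₀ k else curveVec u (z k) :=
    funext fun k => jcol_fillTab hsingle hpriv z k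
  rwa [hcols]

end realise

/-! ## 4. Zeta cores: indicator points of distinct rows are independent -/

omit [Fintype n] [DecidableEq n] in
/-- If every core point is the indicator vector of the row `u (φ k)` then the core column `k` is the zeta vector
`[u i ⊆ u (φ k)]_i`. -/
theorem jcol_eq_zeta (u : n → Finset (Fin h)) (e : n → Fin m × Finset (Fin K))
    (tx₀ : Fin m → Option (Fin K) → Fin h → ℂ) (φ : n → n) (k : n)
    (hk : ∀ a, jpt tx₀ (e k) a = if a ∈ u (φ k) then 1 else 0) (i : n) :
    jcol u e tx₀ k i = if u i ⊆ u (φ k) then 1 else 0 := by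
  classical
  simp only [jcol]
  simp_rw [hk]
  rw [Finset.prod_boole]
  by_cases hsub : u i ⊆ u (φ k)
  · rw [if_pos hsub, if_pos (fun a ha => hsub ha)]
  · rw [if_neg hsub, if_neg (fun hall => hsub (fun a ha => hall a ha))]

/-- **Zeta cores are independent.** If the core points are indicator vectors of the rows `u (φ k)` with `u ∘ φ` injective,
the core columns are independent. -/
theorem indepOn_of_labels (u : n → Finset (Fin h)) (e : n → Fin m × Finset (Fin K))
    (tx₀ : Fin m → Option (Fin K) → Fin h → ℂ) (A : Finset n) (φ : n → n) (hφ : Function.Injective (u ∘ φ))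
    (hlab : ∀ k ∈ A, ∀ a, jpt tx₀ (e k) a = if a ∈ u (φ k) then 1 else 0) :
    IndepOn (jcol u e tx₀) A := by
  classical
  intro α hαA hsum
  refine TwoLayer.eq_zero_of_zeta (u ∘ φ) hφ (jcol u e tx₀) A φ ?_ α hαA ?_
  · intro k _ k' hk'
    exact jcol_eq_zeta u e tx₀ φ k' (hlab k' hk') (φ k)
  · rw [← hsum]
    symm
    exact Finset.sum_subset (Finset.subset_univ A) fun k _ hk => by rw [hαA k hk, zero_smul]

end JoinFilling

end

end Summit.ValiantsHypothesis.ValiantsHypothesis.Theorems.BarrierLever.HiddenStates
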